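import Literature.Computability.AlgebraicComplexity.RankMethodBarriers
import Mathlib.FieldTheory.IsAlgClosed.AlgebraicClosure
import Mathlib.RingTheory.Localization.FractionRing
import Mathlib.RingTheory.MvPowerSeries.Basic
import HarnessLib

/-!
# The "numeric to symbolic" transfer (Garg–Makam–Oliveira–Wigderson 2019, §1.5, §3.2, §4)

Topic file accompanying the barrier entry `Literature.Barriers.ValiantsHypothesis.RankLifting`
(`RankLiftingBarrier.lean`): the algebro-geometric input of the proofs of GMOW's Theorems 1.14,
1.16, 1.18, 1.19, vendored as NAMED FACTS with the paper's numbering, together with the two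
(proved) implications the paper uses to chain them:

* `GMOW2019_prop33` — **Proposition 3.3** (symbolic solutions over `K̄`, `K = F(z)`): if
  `im L ⊆ im M` pointwise for polynomial maps `L : F^n → F^m`, `M : F^r → F^m` over an
  algebraically closed `F`, then `L(z) = M(b(z))` for some algebraic functions
  `b₁, …, b_r ∈ K̄` (proof printed in §4.1, via Hilbert's Nullstellensatz).
* `GMOW2019_prop34` — **Proposition 3.4** (power series for algebraic functions): for finitely
  many `b₁, …, b_r ∈ K̄`, `F` algebraically closed of characteristic zero, some `c ∈ F^n` admits
  an `F`-algebra homomorphism `F[z, b₁, …, b_r] → F[[z - c]]` extending `F[z] ↪ F[[z - c]]`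
  (proof printed in §4.2, via generic étaleness and completion).
* `GMOW2019_thm121` — **Theorem 1.21** (the transfer): `im L ⊆ im M` implies
  `L(z + c) = M(p₁(z), …, p_r(z))` for some `c ∈ F^n` and power series `pᵢ` around `0`;
  PROVED here from the two propositions exactly as in §4 ("Proof of Theorem 1.21"):
  `GMOW2019_thm121_of_prop33_of_prop34`.
* `GMOW2019_cor123` — **Corollary 1.23** (tensor-rank instance): if `trk(L(β)) ≤ a` for every
  evaluation of a polynomial map `L : F^n → Ten(m,k)`, then
  `L(z + c) = ∑_{i ≤ a} p_i^{(1)}(z) ⊗ ⋯ ⊗ p_i^{(k)}(z)` with vectors of power series; PROVED here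
  from Theorem 1.21 as in §4 ("Proof of Corollary 1.23": `M` parametrises the tensors of rank
  `≤ a`): `GMOW2019_cor123_of_thm121`.

**Rendering.** A polynomial map `F^σ → F^ι` is a family `L : ι → MvPolynomial σ F`, evaluated
with `MvPolynomial.eval`; `im L ⊆ im M` is `∀ β, ∃ γ, ∀ i, eval β (L i) = eval γ (M i)`. Power
series around `c` are rendered in the variable `w = z - c`, i.e. as `MvPowerSeries σ F`, under
which the inclusion `F[z] ↪ F[[z - c]]` is `z_v ↦ w_v + c_v` and `L(z + c)` is the polynomial
`aeval (X + C c) (L i)` coerced to a power series. `K̄` is Mathlib's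
`AlgebraicClosure (FractionRing (MvPolynomial σ F))`. Proposition 3.4 is rendered without
subalgebra types, as RELATION TRANSFER: every polynomial relation `G(z, b) = 0` over `F` stays
true after `z ↦ w + c`, `b ↦ p` — by the first isomorphism theorem this is exactly the existence
of the printed homomorphism on `F[z, b] = im (aeval (z, b))` with `b_j ↦ p_j`. Tensors and tensor
rank are the tree's `(Fin k → Fin m) → F` and `tensorRankD` (`RankMethodBarriers.lean`);
Corollary 1.23 carries `0 < k` (a `k`-tensor has at least one factor; for `k = 0` the tree's
`tensorRankD` is a junk value).

What is NOT here: the proofs of Propositions 3.3 and 3.4 (to be discharged in sibling files),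
and §5 (the barrier theorems themselves, `RankLiftingBarrier.lean` / `RankLiftingBarrierProofs.lean`).

## References

* [GargMakamOliveiraWigderson2019] A. Garg, V. Makam, R. Oliveira, A. Wigderson, *More barriers
  for rank methods, via a "numeric to symbolic" transfer*, FOCS 2019 (arXiv:1904.04299):
  Thm. 1.21, Rem. 1.22, Cor. 1.23 (§1.5); Props. 3.3, 3.4 (§3.2); §4 (Lemmas 4.1, 4.3–4.5 and
  the proofs of Prop. 3.3, Prop. 3.4, Thm. 1.21, Cor. 1.23).
-/

noncomputable section

namespace Literature.Barriers.ValiantsHypothesis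

open Literature.Computability.AlgebraicComplexity MvPolynomial
open scoped BigOperators

/-! ### The named facts -/

/-- **Garg–Makam–Oliveira–Wigderson 2019, Proposition 3.3.** Let `F` be algebraically closed,
`L : F^n → F^m` and `M : F^r → F^m` polynomial maps with `im(L) ⊆ im(M)`, `z = (z₁, …, z_n)`
indeterminates and `K = F(z₁, …, z_n)`. Then there are algebraic functions
`b₁(z), …, b_r(z) ∈ K̄` with `L(z) = M(b₁(z), …, b_r(z))`. (Index sets: `σ` for the `n`
variables, `τ` for the `r` parameters, `ι` for the `m` coordinates, all finite.)
[cite: GargMakamOliveiraWigderson2019, Prop. 3.3] -/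
def GMOW2019_prop33 : Prop :=
  ∀ (F : Type) [Field F] [IsAlgClosed F] (σ τ ι : Type) [Finite σ] [Finite τ] [Finite ι]
    (L : ι → MvPolynomial σ F) (M : ι → MvPolynomial τ F),
    (∀ β : σ → F, ∃ γ : τ → F, ∀ i, eval β (L i) = eval γ (M i)) →
    ∃ b : τ → AlgebraicClosure (FractionRing (MvPolynomial σ F)),
      ∀ i, algebraMap (MvPolynomial σ F) (AlgebraicClosure (FractionRing (MvPolynomial σ F)))
        (L i) = aeval b (M i)

/-- **Garg–Makam–Oliveira–Wigderson 2019, Proposition 3.4.** Let `F` be algebraically closed of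
characteristic zero and `b₁(z), …, b_r(z) ∈ K̄ = \overline{F(z₁, …, z_n)}` finitely many
elements. Then for some `c ∈ F^n` ("a generic choice will do") there is an `F`-algebra
homomorphism `F[z₁, …, z_n, b₁(z), …, b_r(z)] → F[[z - c]]` extending the canonical inclusion
`F[z₁, …, z_n] ↪ F[[z - c]]`. Rendered as relation transfer in the variable `w = z - c` (module
docstring): there are `c` and power series `p₁, …, p_r ∈ F[[w]]` such that every polynomial
relation `G(z, b) = 0` with coefficients in `F` implies `G(w + c, p) = 0`.
[cite: GargMakamOliveiraWigderson2019, Prop. 3.4] -/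
def GMOW2019_prop34 : Prop :=
  ∀ (F : Type) [Field F] [IsAlgClosed F] [CharZero F] (σ τ : Type) [Finite σ] [Finite τ]
    (b : τ → AlgebraicClosure (FractionRing (MvPolynomial σ F))),
    ∃ (c : σ → F) (p : τ → MvPowerSeries σ F),
      ∀ G : MvPolynomial (σ ⊕ τ) F,
        aeval (Sum.elim (fun v => algebraMap (MvPolynomial σ F)
          (AlgebraicClosure (FractionRing (MvPolynomial σ F))) (X v)) b) G = 0 →
        aeval (Sum.elim (fun v => (MvPowerSeries.X v + MvPowerSeries.C (c v) : MvPowerSeries σ F))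
          p) G = 0

/-- **Garg–Makam–Oliveira–Wigderson 2019, Theorem 1.21 (numeric to symbolic transfer).** Let `F`
be algebraically closed of characteristic zero, `L : F^n → F^m` and `M : F^r → F^m` polynomial
maps with `im(L) ⊆ im(M)`, `z = (z₁, …, z_n)` indeterminates. Then there is `c ∈ F^n` with
`L(z + c) = M(p₁(z), …, p_r(z))` for some (`n`-variate) power series `p₁(z), …, p_r(z)` around
`0` — an identity of vectors of power series. [cite: GargMakamOliveiraWigderson2019, Thm. 1.21] -/
def GMOW2019_thm121 : Prop :=
  ∀ (F : Type) [Field F] [IsAlgClosed F] [CharZero F] (σ τ ι : Type) [Finite σ] [Finite τ]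
    [Finite ι] (L : ι → MvPolynomial σ F) (M : ι → MvPolynomial τ F),
    (∀ β : σ → F, ∃ γ : τ → F, ∀ i, eval β (L i) = eval γ (M i)) →
    ∃ (c : σ → F) (p : τ → MvPowerSeries σ F),
      ∀ i, ((aeval (fun v => (X v + C (c v) : MvPolynomial σ F)) (L i) : MvPolynomial σ F) :
        MvPowerSeries σ F) = aeval p (M i)

/-- **Garg–Makam–Oliveira–Wigderson 2019, Corollary 1.23.** Let `F` be algebraically closed of
characteristic zero and `L : F^n → Ten(m,k)` a polynomial map with `trk(L(β)) ≤ a` for all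
`β ∈ F^n`. Then there is `c ∈ F^n` and a power series decomposition
`L(z + c) = ∑_{i=1}^{a} p_i^{(1)}(z) ⊗ p_i^{(2)}(z) ⊗ ⋯ ⊗ p_i^{(k)}(z)` with `p_i^{(j)}(z)` an
`m`-dimensional vector of power series around `0` (`0 < k`: see the module docstring).
[cite: GargMakamOliveiraWigderson2019, Cor. 1.23] -/
def GMOW2019_cor123 : Prop :=
  ∀ (F : Type) [Field F] [IsAlgClosed F] [CharZero F] (σ : Type) [Finite σ] (m k a : ℕ),
    0 < k → ∀ (L : (Fin k → Fin m) → MvPolynomial σ F),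
    (∀ β : σ → F, tensorRankD (fun i => eval β (L i)) ≤ a) →
    ∃ (c : σ → F) (p : Fin a → Fin k → Fin m → MvPowerSeries σ F),
      ∀ i : Fin k → Fin m,
        ((aeval (fun v => (X v + C (c v) : MvPolynomial σ F)) (L i) : MvPolynomial σ F) :
          MvPowerSeries σ F) = ∑ l, ∏ j, p l j (i j)

/-! ### Theorem 1.21 from Propositions 3.3 and 3.4 (§4, "Proof of Theorem 1.21") -/

/-- The shift `z ↦ w + c` commutes with the coercion of polynomials to power series.
[folklore] -/
theorem coe_aeval_X_add_C {F : Type*} [Field F] {σ : Type*} (c : σ → F)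
    (q : MvPolynomial σ F) :
    ((aeval (fun v => (X v + C (c v) : MvPolynomial σ F)) q : MvPolynomial σ F) :
        MvPowerSeries σ F) =
      aeval (fun v => (MvPowerSeries.X v + MvPowerSeries.C (c v) : MvPowerSeries σ F)) q := by
  induction q using MvPolynomial.induction_on with
  | C a => simp [MvPowerSeries.algebraMap_apply]
  | add p q hp hq => simp [hp, hq]
  | mul_X p v hp => simp [hp]

/-- Over `K̄ ⊇ F[z]`, evaluating an `F`-polynomial at the variables is the structure map.
[folklore] -/
theorem aeval_algebraMap_X_eq {F : Type*} [Field F] {σ : Type*} {A : Type*} [CommRing A]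
    [Algebra F A] [Algebra (MvPolynomial σ F) A] [IsScalarTower F (MvPolynomial σ F) A]
    (q : MvPolynomial σ F) :
    aeval (fun v => algebraMap (MvPolynomial σ F) A (X v)) q = algebraMap (MvPolynomial σ F) A q := by
  have h := comp_aeval (R := F) (X : σ → MvPolynomial σ F)
    (IsScalarTower.toAlgHom F (MvPolynomial σ F) A)
  rw [aeval_X_left, AlgHom.comp_id] at h
  have := congrArg (fun f => f q) h
  simpa using this.symm

/-- **Theorem 1.21 from Propositions 3.3 and 3.4**, as in the paper: Proposition 3.3 gives
`L(z) = M(b(z))` with `b_j ∈ K̄`; the homomorphism `F[z, b] → F[[z - c]]` of Proposition 3.4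
replaces each `b_j` by a power series around `c`, and the shift `z ↦ z + c` gives the conclusion.
[cite: GargMakamOliveiraWigderson2019, §4 (Proof of Theorem 1.21)] -/
theorem GMOW2019_thm121_of_prop33_of_prop34 (h33 : GMOW2019_prop33) (h34 : GMOW2019_prop34) :
    GMOW2019_thm121 := by
  intro F _ _ _ σ τ ι _ _ _ L M hLM
  obtain ⟨b, hb⟩ := h33 F σ τ ι L M hLM
  obtain ⟨c, p, hcp⟩ := h34 F σ τ b
  refine ⟨c, p, fun i => ?_⟩
  have key := hcp (rename Sum.inl (L i) - rename Sum.inr (M i)) (by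
    rw [map_sub, aeval_rename, aeval_rename, sub_eq_zero, Sum.elim_comp_inl, Sum.elim_comp_inr,
      aeval_algebraMap_X_eq]
    exact hb i)
  rw [map_sub, aeval_rename, aeval_rename, sub_eq_zero, Sum.elim_comp_inl, Sum.elim_comp_inr]
    at key
  rw [coe_aeval_X_add_C, key]

/-! ### Corollary 1.23 from Theorem 1.21 (§4, "Proof of Corollary 1.23") -/

/-- Every `k`-tensor (`0 < k`) is a finite sum of rank-one tensors: `T = ∑_ι T_ι · e_ι` with the
coefficient absorbed into the first factor. [cite: EfremenkoGargOliveiraWigderson2018, §1.2] -/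
theorem exists_sum_rankOneTensor_eq {F : Type*} [Field F] {m k : ℕ} (hk : 0 < k)
    (T : (Fin k → Fin m) → F) :
    ∃ (s : ℕ) (u : Fin s → Fin k → Fin m → F), ∑ q, rankOneTensor (u q) = T := by
  classical
  -- decomposition indexed by the multi-indices, then reindexed by `Fin`
  set u : (Fin k → Fin m) → Fin k → Fin m → F := fun ι j x =>
    (if j = ⟨0, hk⟩ then T ι else 1) * (if x = ι j then 1 else 0) with hu
  have hdec : ∑ ι, rankOneTensor (u ι) = T := by
    funext i
    simp only [Finset.sum_apply, rankOneTensor_apply, hu]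
    rw [Finset.sum_eq_single i]
    · simp
    · intro ι _ hι
      obtain ⟨j, hj⟩ := Function.ne_iff.1 hι
      exact Finset.prod_eq_zero (Finset.mem_univ j) (by simp [Ne.symm hj])
    · simp
  refine ⟨Fintype.card (Fin k → Fin m), fun q => u ((Fintype.equivFin _).symm q), ?_⟩
  rw [← hdec]
  exact Fintype.sum_equiv (Fintype.equivFin _).symm _ _ fun _ => rfl

/-- Padding a rank-one decomposition with zero tensors (`0 < k`). [folklore] -/
theorem sum_rankOneTensor_pad {F : Type*} [Field F] {m k N a : ℕ} (hk : 0 < k) (hNa : N ≤ a)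
    (w : Fin N → Fin k → Fin m → F) :
    ∑ q : Fin a, rankOneTensor (if h : (q : ℕ) < N then w ⟨q, h⟩ else 0) =
      ∑ q : Fin N, rankOneTensor (w q) := by
  have hzero : rankOneTensor (0 : Fin k → Fin m → F) = 0 := by
    funext i
    simp only [rankOneTensor_apply, Pi.zero_apply]
    exact Finset.prod_eq_zero (Finset.mem_univ (⟨0, hk⟩ : Fin k)) rfl
  set f : ℕ → ((Fin k → Fin m) → F) :=
    fun q => if h : q < N then rankOneTensor (w ⟨q, h⟩) else 0 with hf
  have h1 : ∑ q : Fin a, rankOneTensor (if h : (q : ℕ) < N then w ⟨q, h⟩ else 0) =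
      ∑ q : Fin a, f q := by
    refine Finset.sum_congr rfl fun q _ => ?_
    simp only [hf]
    split_ifs <;> simp [hzero]
  have h2 : ∑ q : Fin N, rankOneTensor (w q) = ∑ q : Fin N, f q := by
    refine Finset.sum_congr rfl fun q _ => ?_
    simp [hf, q.2]
  rw [h1, h2, Fin.sum_univ_eq_sum_range f a, Fin.sum_univ_eq_sum_range f N]
  symm
  refine Finset.sum_subset (Finset.range_subset_range.2 hNa) fun q _ hq => ?_
  rw [Finset.mem_range] at hq
  simp [hf, hq]

/-- A tensor of rank `≤ a` is a sum of exactly `a` rank-one tensors (pad with zero tensors,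
`0 < k`). [cite: EfremenkoGargOliveiraWigderson2018, §1.2] -/
theorem exists_sum_rankOneTensor_eq_of_tensorRankD_le {F : Type*} [Field F] {m k a : ℕ}
    (hk : 0 < k) {T : (Fin k → Fin m) → F} (ha : tensorRankD T ≤ a) :
    ∃ u : Fin a → Fin k → Fin m → F, ∑ q, rankOneTensor (u q) = T := by
  classical
  obtain ⟨s, u, hu⟩ := exists_sum_rankOneTensor_eq hk T
  -- a minimal decomposition has `tensorRankD T ≤ a` terms
  obtain ⟨g, hg, hgT⟩ := sComplexity_spec (S := rankOneTensors F m k) (f := T)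
    ⟨s, fun q => rankOneTensor (u q), fun q => rankOneTensor_mem (u q), hu⟩
  choose w hw using hg
  -- pad with zeros
  have ha' : sComplexity (rankOneTensors F m k) T ≤ a := ha
  refine ⟨fun q => if h : (q : ℕ) < sComplexity (rankOneTensors F m k) T then w ⟨q, h⟩ else 0,
    ?_⟩
  show ∑ q : Fin a, rankOneTensor
    (if h : (q : ℕ) < sComplexity (rankOneTensors F m k) T then w ⟨q, h⟩ else 0) = T
  rw [sum_rankOneTensor_pad hk ha' w]
  exact (Finset.sum_congr rfl fun q _ => hw q).trans hgT

/-- **Corollary 1.23 from Theorem 1.21**, as in the paper: apply Theorem 1.21 with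
`M : ((F^m)^k)^a → Ten(m,k)`, `M(v) = ∑_{i ≤ a} v_i^{(1)} ⊗ ⋯ ⊗ v_i^{(k)}`, which parametrises the
tensors of rank `≤ a`, so that `im(L) ⊆ im(M)`.
[cite: GargMakamOliveiraWigderson2019, §4 (Proof of Corollary 1.23)] -/
theorem GMOW2019_cor123_of_thm121 (h : GMOW2019_thm121) : GMOW2019_cor123 := by
  intro F _ _ _ σ _ m k a hk L hL
  classical
  -- the parametrisation of rank-`≤ a` tensors, parameters indexed by `Fin a × Fin k × Fin m`
  set M : (Fin k → Fin m) → MvPolynomial (Fin a × Fin k × Fin m) F :=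
    fun i => ∑ l, ∏ j, X (l, j, i j) with hM
  have hLM : ∀ β : σ → F, ∃ γ : Fin a × Fin k × Fin m → F, ∀ i, eval β (L i) = eval γ (M i) := by
    intro β
    obtain ⟨u, hu⟩ := exists_sum_rankOneTensor_eq_of_tensorRankD_le hk (hL β)
    refine ⟨fun x => u x.1 x.2.1 x.2.2, fun i => ?_⟩
    have := congrFun hu i
    simp only [Finset.sum_apply, rankOneTensor_apply] at this
    simp [hM, this.symm]
  obtain ⟨c, p, hp⟩ := h F σ (Fin a × Fin k × Fin m) (Fin k → Fin m) L M hLM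
  refine ⟨c, fun l j x => p (l, j, x), fun i => ?_⟩
  rw [hp i]
  simp [hM, map_sum, map_prod]

end Literature.Barriers.ValiantsHypothesis
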